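import Mathlib
import HarnessLib
import Summits.Ventures.LatticeQCDFlow.Scoring.SkeletonHoeffding
import Summits.Ventures.LatticeQCDFlow.Scoring.QuantileBand

/-!
# The uniform band for the printed distribution function of a statistic under an `m`-STEP (block,
# sweep) Doeblin certificate, from any start:
# `P_{μ₀}(sup_t |F_π(t) − F̂_N(t)| ≥ η) ≤ 4(⌈2/η⌉ + 1)·exp(−(Nη − 16m/ε)²/(128 N m²/ε²))`

HONEST FRAMING: exact (Metropolis-corrected) sampling algorithms for lattice gauge theory;
figures of merit are autocorrelation/cost numbers at stated couplings and volumes; no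
continuum-physics claim.

Venture `LatticeQCDFlow` (cell pub-lqcd), topic `Scoring`; FANOUT row 4 (`s0-u1-b`, rung S0-B).
`Scoring/ChainEDFBand` needs a ONE-step minorisation `κ(x, ·) ≥ ε π`; a Metropolis or heat-bath
SWEEP, an HMC trajectory family or an interleaved scheme is certified per BLOCK of `m` updates,
`(nHit κ m)(x, ·) ≥ ε π` (`Scoring/DoeblinSkeleton`, `Exactness/MetropolisSweepErgodic`,
`Exactness/HeatBathSweepErgodic`).  This file is the block version of the band, assembled from row
8's `m`-step Hoeffding inequality from any start (`Scoring/SkeletonHoeffding.chain_abs_tail_le_exp_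
of_doeblin_nHit`, applied to the indicators `1{O > q_j}` and `1{O < q_j}` with the constant
`C + |πf|` pinned to `2`) and the deterministic one-function sandwich
`GlivenkoCantelliRate.abs_cdf_sub_lt_of_grid`: **`skeleton_measureReal_exists_edf_dev_ge_le`**
(grid form, `Nδ ≥ 8m/ε`: `P(∃ t, δ + 1/K ≤ |F_π − F̂_N|) ≤ 4(K + 1)·exp(−(Nδ − 8m/ε)²/(32Nm²/ε²))`),
**`…_of_pos`** (the `η` form of the title, `Nη ≥ 16m/ε`) and the all-quantiles corollary
**`skeleton_measureReal_exists_quantile_unbracketed_le`**.  Single-update units throughout: the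
block certificate costs the factor `m` in the offset and `m²` in the Gaussian rate.  NEW WORK of
the cell (not a published result); no definition is introduced.

## Content (`P_{μ₀}` the trajectory law of `κ` itself; `F_π = cdf (π.map O)`)

* `skeleton_measureReal_abs_cdf_sub_edf_ge_le`,
  `skeleton_measureReal_abs_edfStrict_sub_leftLim_ge_le` — the two one-point two-sided tails under
  the block certificate;
* **`skeleton_measureReal_exists_edf_dev_ge_le`**, **`…_of_pos`**;
* **`skeleton_measureReal_exists_quantile_unbracketed_le`**.

NOT CLAIMED: any `(ε, m)` for a concrete sweep; the factor `4` (two-sided tails are used for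
one-sided events) and the other constants are not optimised.
-/

noncomputable section

namespace Summit.Ventures.LatticeQCDFlow.Scoring.GlivenkoCantelli

open MeasureTheory ProbabilityTheory Finset Filter Function Summit.Ventures.LatticeQCDFlow.Exactness
open scoped Topology ENNReal

variable {Ω : Type*} [MeasurableSpace Ω]
variable {κ : Kernel Ω Ω} [IsMarkovKernel κ] {μ₀ : Measure Ω} [IsProbabilityMeasure μ₀]
  {π : Measure Ω} [IsProbabilityMeasure π] {m : ℕ}

/-! ## §1 The two one-point tails under a block certificate -/

section Point

/-- **Two-sided deviation of the chain's empirical distribution function at a point, block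
certificate.**  `π` invariant for `κ`, `(nHit κ m)(x, ·) ≥ ε π` (`ε > 0`, `m ≥ 1`), `O`
measurable, `F_π = cdf (π ∘ O⁻¹)`; `N ≠ 0`, `Nδ ≥ 8m/ε`.  From any initial law,
`P_{μ₀}(δ ≤ |F_π(t) − #{i<N : O(X_i) ≤ t}/N|) ≤ 2·exp(−(Nδ − 8m/ε)²/(32 N m²/ε²))`. [ours]
(`chain_abs_tail_le_exp_of_doeblin_nHit` for `f = 1{O > t}`, `|f| ≤ 2 − |πf|`) -/
theorem skeleton_measureReal_abs_cdf_sub_edf_ge_le (hπ : Kernel.Invariant κ π) {ε : ℝ≥0∞}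
    (hmin : ∀ x {B : Set Ω}, MeasurableSet B → ε * π B ≤ nHit κ m x B) (hm : 0 < m)
    (hε0 : 0 < ε) {O : Ω → ℝ} (hO : Measurable O) (t : ℝ) {N : ℕ} (hN : N ≠ 0) {δ : ℝ}
    (hδ : 8 * m / ε.toReal ≤ N * δ) :
    (Kernel.trajMeasure (X := fun _ : ℕ => Ω) μ₀
          (fun n : ℕ => κ.comap (fun y : (i : ↥(Finset.Iic n)) → Ω => y ⟨n, Finset.mem_Iic.2 le_rfl⟩)
            (measurable_pi_apply _))).real
        {x | δ ≤ |cdf (π.map O) t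
            - (∑ i ∈ range N, (Set.Iic t).indicator (1 : ℝ → ℝ) (O (x i))) / N|}
      ≤ 2 * Real.exp (-(N * δ - 8 * m / ε.toReal) ^ 2 / (32 * N * (m : ℝ) ^ 2 / ε.toReal ^ 2)) := by
  haveI : IsProbabilityMeasure (π.map O) := Measure.isProbabilityMeasure_map hO.aemeasurable
  set P := Kernel.trajMeasure (X := fun _ : ℕ => Ω) μ₀
      (fun n : ℕ => κ.comap (fun y : (i : ↥(Finset.Iic n)) → Ω => y ⟨n, Finset.mem_Iic.2 le_rfl⟩)
        (measurable_pi_apply _)) with hP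
  have hIm : Measurable ((Set.Ioi t).indicator (1 : ℝ → ℝ)) :=
    measurable_one.indicator measurableSet_Ioi
  have hfm : Measurable (fun z => (Set.Ioi t).indicator (1 : ℝ → ℝ) (O z)) := hIm.comp hO
  have hint : ∫ z, (Set.Ioi t).indicator (1 : ℝ → ℝ) (O z) ∂π = 1 - cdf (π.map O) t := by
    rw [← integral_map hO.aemeasurable hIm.aestronglyMeasurable,
      integral_indicator_one measurableSet_Ioi, cdf_eq_real, ← Set.compl_Iic,
      measureReal_compl measurableSet_Iic, probReal_univ]
  have hF0 : 0 ≤ cdf (π.map O) t := cdf_nonneg _ _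
  have hF1 : cdf (π.map O) t ≤ 1 := cdf_le_one _ _
  have hC : ∀ z, |(Set.Ioi t).indicator (1 : ℝ → ℝ) (O z)|
      ≤ 2 - |∫ z, (Set.Ioi t).indicator (1 : ℝ → ℝ) (O z) ∂π| := by
    intro z
    rw [hint, abs_of_nonneg (indicator_one_nonneg _ _), abs_of_nonneg (by linarith)]
    linarith [indicator_one_le_one (Set.Ioi t) (O z)]
  have h42 : (4 : ℝ) * m * 2 = 8 * m := by ring
  have hs : 4 * m * ((2 - |∫ z, (Set.Ioi t).indicator (1 : ℝ → ℝ) (O z) ∂π|)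
      + |∫ z, (Set.Ioi t).indicator (1 : ℝ → ℝ) (O z) ∂π|) / ε.toReal ≤ N * δ := by
    rw [sub_add_cancel, h42]
    exact hδ
  have h := chain_abs_tail_le_exp_of_doeblin_nHit (μ₀ := μ₀) hπ hmin hm hε0 hfm hC hN hs
  beta_reduce at h
  rw [← hP, sub_add_cancel, h42] at h
  have hNpos : (0 : ℝ) < N := by exact_mod_cast Nat.pos_of_ne_zero hN
  have hsub : {x : ℕ → Ω | δ ≤ |cdf (π.map O) t
        - (∑ i ∈ range N, (Set.Iic t).indicator (1 : ℝ → ℝ) (O (x i))) / N|}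
      ⊆ {x | δ ≤ |(∑ i ∈ range N, (Set.Ioi t).indicator (1 : ℝ → ℝ) (O (x i))) / N
        - ∫ z, (Set.Ioi t).indicator (1 : ℝ → ℝ) (O z) ∂π|} := by
    intro x hx
    simp only [Set.mem_setOf_eq] at hx ⊢
    have hsum : ∑ i ∈ range N, (Set.Ioi t).indicator (1 : ℝ → ℝ) (O (x i))
        = N - ∑ i ∈ range N, (Set.Iic t).indicator (1 : ℝ → ℝ) (O (x i)) := by
      have hi : ∀ i, (Set.Ioi t).indicator (1 : ℝ → ℝ) (O (x i))
          = 1 - (Set.Iic t).indicator (1 : ℝ → ℝ) (O (x i)) := fun i => by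
        rw [← Set.compl_Iic, Set.indicator_compl]
        simp
      rw [Finset.sum_congr rfl fun i _ => hi i, Finset.sum_sub_distrib, Finset.sum_const,
        Finset.card_range]
      simp
    rw [hsum, hint, sub_div, div_self hNpos.ne']
    have e : 1 - (∑ i ∈ range N, (Set.Iic t).indicator (1 : ℝ → ℝ) (O (x i))) / N
        - (1 - cdf (π.map O) t) = cdf (π.map O) t
        - (∑ i ∈ range N, (Set.Iic t).indicator (1 : ℝ → ℝ) (O (x i))) / N := by ring
    rw [e]
    exact hx
  refine (measureReal_mono hsub).trans (h.trans (le_of_eq ?_))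
  congr 2
  ring

/-- **Two-sided deviation of the chain's STRICT empirical distribution function at a point, block
certificate**: `P_{μ₀}(δ ≤ |#{i<N : O(X_i) < t}/N − F_π(t−)|) ≤ 2·exp(−(Nδ − 8m/ε)²/(32Nm²/ε²))`
for `Nδ ≥ 8m/ε`. [ours] (`chain_abs_tail_le_exp_of_doeblin_nHit` for `f = 1{O < t}`) -/
theorem skeleton_measureReal_abs_edfStrict_sub_leftLim_ge_le (hπ : Kernel.Invariant κ π)
    {ε : ℝ≥0∞} (hmin : ∀ x {B : Set Ω}, MeasurableSet B → ε * π B ≤ nHit κ m x B) (hm : 0 < m)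
    (hε0 : 0 < ε) {O : Ω → ℝ} (hO : Measurable O) (t : ℝ) {N : ℕ} (hN : N ≠ 0) {δ : ℝ}
    (hδ : 8 * m / ε.toReal ≤ N * δ) :
    (Kernel.trajMeasure (X := fun _ : ℕ => Ω) μ₀
          (fun n : ℕ => κ.comap (fun y : (i : ↥(Finset.Iic n)) → Ω => y ⟨n, Finset.mem_Iic.2 le_rfl⟩)
            (measurable_pi_apply _))).real
        {x | δ ≤ |(∑ i ∈ range N, (Set.Iio t).indicator (1 : ℝ → ℝ) (O (x i))) / N
            - Function.leftLim (cdf (π.map O)) t|}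
      ≤ 2 * Real.exp (-(N * δ - 8 * m / ε.toReal) ^ 2 / (32 * N * (m : ℝ) ^ 2 / ε.toReal ^ 2)) := by
  haveI : IsProbabilityMeasure (π.map O) := Measure.isProbabilityMeasure_map hO.aemeasurable
  set P := Kernel.trajMeasure (X := fun _ : ℕ => Ω) μ₀
      (fun n : ℕ => κ.comap (fun y : (i : ↥(Finset.Iic n)) → Ω => y ⟨n, Finset.mem_Iic.2 le_rfl⟩)
        (measurable_pi_apply _)) with hP
  have hIm : Measurable ((Set.Iio t).indicator (1 : ℝ → ℝ)) :=
    measurable_one.indicator measurableSet_Iio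
  have hfm : Measurable (fun z => (Set.Iio t).indicator (1 : ℝ → ℝ) (O z)) := hIm.comp hO
  have hint : ∫ z, (Set.Iio t).indicator (1 : ℝ → ℝ) (O z) ∂π
      = Function.leftLim (cdf (π.map O)) t := by
    rw [← integral_map hO.aemeasurable hIm.aestronglyMeasurable,
      integral_indicator_one measurableSet_Iio, leftLim_cdf_eq_real]
  have hL0 : 0 ≤ Function.leftLim (cdf (π.map O)) t := by
    rw [leftLim_cdf_eq_real]; exact measureReal_nonneg
  have hL1 : Function.leftLim (cdf (π.map O)) t ≤ 1 := by
    rw [leftLim_cdf_eq_real]; exact measureReal_le_one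
  have hC : ∀ z, |(Set.Iio t).indicator (1 : ℝ → ℝ) (O z)|
      ≤ 2 - |∫ z, (Set.Iio t).indicator (1 : ℝ → ℝ) (O z) ∂π| := by
    intro z
    rw [hint, abs_of_nonneg (indicator_one_nonneg _ _), abs_of_nonneg hL0]
    linarith [indicator_one_le_one (Set.Iio t) (O z)]
  have h42 : (4 : ℝ) * m * 2 = 8 * m := by ring
  have hs : 4 * m * ((2 - |∫ z, (Set.Iio t).indicator (1 : ℝ → ℝ) (O z) ∂π|)
      + |∫ z, (Set.Iio t).indicator (1 : ℝ → ℝ) (O z) ∂π|) / ε.toReal ≤ N * δ := by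
    rw [sub_add_cancel, h42]
    exact hδ
  have h := chain_abs_tail_le_exp_of_doeblin_nHit (μ₀ := μ₀) hπ hmin hm hε0 hfm hC hN hs
  beta_reduce at h
  rw [← hP, sub_add_cancel, h42, hint] at h
  refine h.trans (le_of_eq ?_)
  congr 2
  ring

end Point

/-! ## §2 The uniform band under a block certificate -/

section Band

/-- **THE UNIFORM BAND UNDER A BLOCK DOEBLIN CERTIFICATE (grid form), FROM ANY START.**  `π`
invariant for `κ`, `(nHit κ m)(x, ·) ≥ ε π` (`ε > 0`, `m ≥ 1`), `O` measurable,
`F_π = cdf (π ∘ O⁻¹)` (atoms allowed), `F̂_N(t) = #{i<N : O(X_i) ≤ t}/N`; `K ≥ 1`, `δ > 0`, `N ≠ 0`,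
`Nδ ≥ 8m/ε`.  Then
`P_{μ₀}(∃ t, δ + 1/K ≤ |F_π(t) − F̂_N(t)|) ≤ 4(K + 1)·exp(−(Nδ − 8m/ε)²/(32Nm²/ε²))`. [ours] -/
theorem skeleton_measureReal_exists_edf_dev_ge_le (hπ : Kernel.Invariant κ π) {ε : ℝ≥0∞}
    (hmin : ∀ x {B : Set Ω}, MeasurableSet B → ε * π B ≤ nHit κ m x B) (hm : 0 < m)
    (hε0 : 0 < ε) {O : Ω → ℝ} (hO : Measurable O) {K : ℕ} (hK : 1 ≤ K) {N : ℕ} (hN : N ≠ 0)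
    {δ : ℝ} (hδ0 : 0 < δ) (hδ : 8 * m / ε.toReal ≤ N * δ) :
    (Kernel.trajMeasure (X := fun _ : ℕ => Ω) μ₀
          (fun n : ℕ => κ.comap (fun y : (i : ↥(Finset.Iic n)) → Ω => y ⟨n, Finset.mem_Iic.2 le_rfl⟩)
            (measurable_pi_apply _))).real
        {x | ∃ t : ℝ, δ + 1 / K ≤ |cdf (π.map O) t
            - (∑ i ∈ range N, (Set.Iic t).indicator (1 : ℝ → ℝ) (O (x i))) / N|}
      ≤ 4 * ((K : ℝ) + 1)
          * Real.exp (-(N * δ - 8 * m / ε.toReal) ^ 2 / (32 * N * (m : ℝ) ^ 2 / ε.toReal ^ 2)) := by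
  haveI : IsProbabilityMeasure (π.map O) := Measure.isProbabilityMeasure_map hO.aemeasurable
  set P := Kernel.trajMeasure (X := fun _ : ℕ => Ω) μ₀
      (fun n : ℕ => κ.comap (fun y : (i : ↥(Finset.Iic n)) → Ω => y ⟨n, Finset.mem_Iic.2 le_rfl⟩)
        (measurable_pi_apply _)) with hP
  set ρ : Measure ℝ := π.map O with hρ
  set q : ℕ → ℝ := fun j => sInf {x | (j : ℝ) / K ≤ cdf ρ x} with hq
  set A : ℕ → Set (ℕ → Ω) := fun j => {x | δ ≤ |cdf ρ (q j)
    - (∑ i ∈ range N, (Set.Iic (q j)).indicator (1 : ℝ → ℝ) (O (x i))) / N|} with hA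
  set B : ℕ → Set (ℕ → Ω) := fun j => {x | δ ≤ |(∑ i ∈ range N,
    (Set.Iio (q j)).indicator (1 : ℝ → ℝ) (O (x i))) / N - Function.leftLim (cdf ρ) (q j)|} with hB
  have hsub : {x : ℕ → Ω | ∃ t : ℝ, δ + 1 / K ≤ |cdf ρ t
        - (∑ i ∈ range N, (Set.Iic t).indicator (1 : ℝ → ℝ) (O (x i))) / N|}
      ⊆ ⋃ j ∈ Finset.range (K + 1), (A j ∪ B j) := by
    rintro x ⟨t, ht⟩
    by_contra hgood
    have hnot : ∀ j, j ≤ K → x ∉ A j ∧ x ∉ B j := by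
      intro j hj
      have hjm : j ∈ Finset.range (K + 1) := Finset.mem_range.2 (by omega)
      exact ⟨fun h => hgood (Set.mem_iUnion₂.2 ⟨j, hjm, Set.mem_union_left _ h⟩),
        fun h => hgood (Set.mem_iUnion₂.2 ⟨j, hjm, Set.mem_union_right _ h⟩)⟩
    have hlt := abs_cdf_sub_lt_of_grid ρ
      (F₁ := fun s => (∑ i ∈ range N, (Set.Iic s).indicator (1 : ℝ → ℝ) (O (x i))) / N)
      (G₁ := fun s => (∑ i ∈ range N, (Set.Iio s).indicator (1 : ℝ → ℝ) (O (x i))) / N)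
      (fun u v huv => div_le_div_of_nonneg_right (sum_le_sum fun i _ => indicator_Iic_mono _ huv)
        (Nat.cast_nonneg N))
      (fun s => div_nonneg (sum_nonneg fun i _ => indicator_one_nonneg _ _) (Nat.cast_nonneg N))
      (fun s => div_le_one_of_le₀ ((sum_le_sum fun i _ => indicator_one_le_one _ _).trans
        (by simp)) (Nat.cast_nonneg N))
      (fun u v huv => div_le_div_of_nonneg_right (sum_le_sum fun i _ => indicator_Iic_le_Iio huv _)
        (Nat.cast_nonneg N))
      hK hδ0
      (fun j hj => by
        have h := (hnot j hj).1
        simp only [hA, Set.mem_setOf_eq, not_le] at h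
        have h' := (abs_lt.1 h).2
        show cdf ρ (q j) - δ < (∑ i ∈ range N, (Set.Iic (q j)).indicator (1 : ℝ → ℝ) (O (x i))) / N
        linarith)
      (fun j hj => by
        have h := (hnot j hj).2
        simp only [hB, Set.mem_setOf_eq, not_le] at h
        have h' := (abs_lt.1 h).2
        show (∑ i ∈ range N, (Set.Iio (q j)).indicator (1 : ℝ → ℝ) (O (x i))) / N
          < Function.leftLim (cdf ρ) (q j) + δ
        linarith)
      t
    exact absurd ht (not_le.2 hlt)
  have hAj : ∀ j, P.real (A j)
      ≤ 2 * Real.exp (-(N * δ - 8 * m / ε.toReal) ^ 2 / (32 * N * (m : ℝ) ^ 2 / ε.toReal ^ 2)) :=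
    fun j => skeleton_measureReal_abs_cdf_sub_edf_ge_le (μ₀ := μ₀) hπ hmin hm hε0 hO (q j) hN hδ
  have hBj : ∀ j, P.real (B j)
      ≤ 2 * Real.exp (-(N * δ - 8 * m / ε.toReal) ^ 2 / (32 * N * (m : ℝ) ^ 2 / ε.toReal ^ 2)) :=
    fun j =>
      skeleton_measureReal_abs_edfStrict_sub_leftLim_ge_le (μ₀ := μ₀) hπ hmin hm hε0 hO (q j) hN hδ
  calc P.real {x : ℕ → Ω | ∃ t : ℝ, δ + 1 / K ≤ |cdf ρ t
          - (∑ i ∈ range N, (Set.Iic t).indicator (1 : ℝ → ℝ) (O (x i))) / N|}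
      ≤ P.real (⋃ j ∈ Finset.range (K + 1), (A j ∪ B j)) :=
        measureReal_mono hsub (measure_ne_top _ _)
    _ ≤ ∑ j ∈ Finset.range (K + 1), P.real (A j ∪ B j) := measureReal_biUnion_finset_le _ _
    _ ≤ ∑ j ∈ Finset.range (K + 1),
          (2 * Real.exp (-(N * δ - 8 * m / ε.toReal) ^ 2 / (32 * N * (m : ℝ) ^ 2 / ε.toReal ^ 2))
            + 2 * Real.exp (-(N * δ - 8 * m / ε.toReal) ^ 2
              / (32 * N * (m : ℝ) ^ 2 / ε.toReal ^ 2))) :=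
        sum_le_sum fun j _ => (measureReal_union_le _ _).trans (add_le_add (hAj j) (hBj j))
    _ = 4 * ((K : ℝ) + 1)
          * Real.exp (-(N * δ - 8 * m / ε.toReal) ^ 2 / (32 * N * (m : ℝ) ^ 2 / ε.toReal ^ 2)) := by
        rw [Finset.sum_const, Finset.card_range, nsmul_eq_mul]
        push_cast
        ring

/-- **THE UNIFORM BAND UNDER A BLOCK DOEBLIN CERTIFICATE (`η` form).**  Same setting; `η > 0`,
`N ≠ 0`, `Nη ≥ 16m/ε`.  Then
`P_{μ₀}(∃ t, η ≤ |F_π(t) − F̂_N(t)|) ≤ 4(⌈2/η⌉ + 1)·exp(−(Nη − 16m/ε)²/(128 N m²/ε²))`. [ours] -/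
theorem skeleton_measureReal_exists_edf_dev_ge_le_of_pos (hπ : Kernel.Invariant κ π)
    {ε : ℝ≥0∞} (hmin : ∀ x {B : Set Ω}, MeasurableSet B → ε * π B ≤ nHit κ m x B) (hm : 0 < m)
    (hε0 : 0 < ε) {O : Ω → ℝ} (hO : Measurable O) {N : ℕ} (hN : N ≠ 0) {η : ℝ} (hη : 0 < η)
    (hNη : 16 * m / ε.toReal ≤ N * η) :
    (Kernel.trajMeasure (X := fun _ : ℕ => Ω) μ₀
          (fun n : ℕ => κ.comap (fun y : (i : ↥(Finset.Iic n)) → Ω => y ⟨n, Finset.mem_Iic.2 le_rfl⟩)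
            (measurable_pi_apply _))).real
        {x | ∃ t : ℝ, η ≤ |cdf (π.map O) t
            - (∑ i ∈ range N, (Set.Iic t).indicator (1 : ℝ → ℝ) (O (x i))) / N|}
      ≤ 4 * ((⌈2 / η⌉₊ : ℝ) + 1)
          * Real.exp (-(N * η - 16 * m / ε.toReal) ^ 2
            / (128 * N * (m : ℝ) ^ 2 / ε.toReal ^ 2)) := by
  set K : ℕ := ⌈2 / η⌉₊ with hK
  have hKpos : 1 ≤ K :=
    Nat.one_le_iff_ne_zero.2 (Nat.pos_iff_ne_zero.1 (Nat.ceil_pos.2 (by positivity)))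
  have hK0 : (0 : ℝ) < K := by exact_mod_cast hKpos
  have hKη : 1 / (K : ℝ) ≤ η / 2 := by
    have hle : 2 / η ≤ (K : ℝ) := Nat.le_ceil _
    rw [div_le_iff₀ hK0]
    rw [div_le_iff₀ hη] at hle
    linarith [mul_comm (K : ℝ) η]
  have hδ : 8 * m / ε.toReal ≤ N * (η / 2) := by
    have : (16 : ℝ) * m / ε.toReal = 2 * (8 * m / ε.toReal) := by ring
    linarith
  have h := skeleton_measureReal_exists_edf_dev_ge_le (μ₀ := μ₀) hπ hmin hm hε0 hO hKpos hN
    (half_pos hη) hδ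
  have hsub : {x : ℕ → Ω | ∃ t : ℝ, η ≤ |cdf (π.map O) t
        - (∑ i ∈ range N, (Set.Iic t).indicator (1 : ℝ → ℝ) (O (x i))) / N|}
      ⊆ {x | ∃ t : ℝ, η / 2 + 1 / K ≤ |cdf (π.map O) t
        - (∑ i ∈ range N, (Set.Iic t).indicator (1 : ℝ → ℝ) (O (x i))) / N|} := by
    rintro x ⟨t, ht⟩
    exact ⟨t, le_trans (by linarith) ht⟩
  refine (measureReal_mono hsub).trans (h.trans (le_of_eq ?_))
  congr 1
  congr 1
  haveI := isMarkovKernel_nHit κ m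
  obtain ⟨-, -, -, -, -, he⟩ := half_const_bounds hmin hε0
  have hNr : (0 : ℝ) < N := by exact_mod_cast Nat.pos_of_ne_zero hN
  have hmr : (0 : ℝ) < m := by exact_mod_cast hm
  field_simp
  ring

end Band

/-! ## §3 All sample quantiles under a block certificate -/

section Quantiles

/-- **ALL SAMPLE QUANTILES OF THE CHAIN OUTPUT AT ONCE, block certificate.**  Same setting;
`η > 0`, `N ≠ 0`, `Nη ≥ 16m/ε`.  From any initial law, the probability that some empirical
quantile `q̂_N(u)`, `u ∈ (η, 1 − η)`, falls outside `[q_π(u − η), q_π(u + η)]` is at most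
`4(⌈2/η⌉ + 1)·exp(−(Nη − 16m/ε)²/(128 N m²/ε²))`. [ours] -/
theorem skeleton_measureReal_exists_quantile_unbracketed_le (hπ : Kernel.Invariant κ π)
    {ε : ℝ≥0∞} (hmin : ∀ x {B : Set Ω}, MeasurableSet B → ε * π B ≤ nHit κ m x B) (hm : 0 < m)
    (hε0 : 0 < ε) {O : Ω → ℝ} (hO : Measurable O) {N : ℕ} (hN : N ≠ 0) {η : ℝ} (hη : 0 < η)
    (hNη : 16 * m / ε.toReal ≤ N * η) :
    (Kernel.trajMeasure (X := fun _ : ℕ => Ω) μ₀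
          (fun n : ℕ => κ.comap (fun y : (i : ↥(Finset.Iic n)) → Ω => y ⟨n, Finset.mem_Iic.2 le_rfl⟩)
            (measurable_pi_apply _))).real
        {x | ∃ u : ℝ, η < u ∧ u + η < 1 ∧
          ¬ (sInf {y | u - η ≤ cdf (π.map O) y}
                ≤ sInf {y | u ≤ cdf (((N : ℝ≥0∞)⁻¹) • ∑ i ∈ range N, Measure.dirac (O (x i))) y}
              ∧ sInf {y | u ≤ cdf (((N : ℝ≥0∞)⁻¹) • ∑ i ∈ range N, Measure.dirac (O (x i))) y}
                ≤ sInf {y | u + η ≤ cdf (π.map O) y})}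
      ≤ 4 * ((⌈2 / η⌉₊ : ℝ) + 1)
          * Real.exp (-(N * η - 16 * m / ε.toReal) ^ 2
            / (128 * N * (m : ℝ) ^ 2 / ε.toReal ^ 2)) := by
  haveI : IsProbabilityMeasure (π.map O) := Measure.isProbabilityMeasure_map hO.aemeasurable
  have hN1 : 1 ≤ N := Nat.one_le_iff_ne_zero.2 hN
  refine le_trans (measureReal_mono ?_)
    (skeleton_measureReal_exists_edf_dev_ge_le_of_pos (μ₀ := μ₀) hπ hmin hm hε0 hO hN hη hNη)
  rintro x ⟨u, hηu, huη, hnot⟩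
  by_contra hgood
  simp only [Set.mem_setOf_eq, not_exists, not_le] at hgood
  haveI := isProbabilityMeasure_empiricalMeasure (fun i => O (x i)) hN1
  refine hnot (quantile_bracket_of_abs_cdf_sub_lt (π.map O)
    (((N : ℝ≥0∞)⁻¹) • ∑ i ∈ range N, Measure.dirac (O (x i))) hη hηu huη fun t => ?_)
  rw [cdf_empiricalMeasure (fun i => O (x i)) hN1 t]
  exact hgood t

end Quantiles

end Summit.Ventures.LatticeQCDFlow.Scoring.GlivenkoCantelli

end
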